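import Summits.CriticalPhenomena.PercolationContinuityZ3.Theorems.PercNearOneGluingNoHeavyLowerTailSahiCombTriWAndClawPlus

/-!
# AND with the block `cocover5 = claw 5 ∪ {⊤∖{p₁,q₁}, ⊤∖{p₂,q₂}}` (two prongs of the claw doubled; the co-covering block `e888a000`)

Support file of the one-cut programme (crux `NoHeavyLowerTail`, stmt-CriticalPhenomena-4575; unit `prim-lf-1` gen 49), continuation of
`…SahiCombTriWAndClaw` / `…SahiCombTriWAndClawPlus`.  `clawPlusTwo p₁ q₁ p₂ q₂ = clawPlus p₁ q₁ ∪ {univ ∖ {p₂,q₂}}` for two DISJOINT pairs; for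
`k = 5` this is `maj3(x_{p₁}x_{q₁}, x_{p₂}x_{q₂}, x_r)` = the block `cocover5 = e888a000 = ↑014 ∪ ↑023 ∪ ↑1234` of the unit's catalogue (three pairwise
co-covering generators), the smallest member of the conjectured family "claw ∘ (AND blocks)" (memo `FROM-prim-lf-1-gen49-CLAW.md` §3) beyond
`claw` and `clawPlus`.
* `clawPlusTwo`, `mem_clawPlusTwo`, `sum_clawPlusTwo`, `isUpperSet_clawPlusTwo`, `disjoint_clawPlusTwo_refl` (`k ≥ 5`); the two extra columns
  `v_i = clawV A p_i q_i`: `clawV_add_clawV_nonneg`; their minimum / maximum `clawVmin/clawVmax` with the K-facts (`clawVmax_pair`, `clawVsum_pair`,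
  `clawVmin/max_add_clawS_pair`, `clawVmax_le_clawS`, **`clawVmin_le_clawS`**: the minimum lies below FOUR co-atom columns, hence below `s_{k-4}`),
  `rearr_two`.
* **`corP_andProd_clawPlusTwo_nonneg`** (`k = 5`): `Cor_{P₁ ∧ cocover5}(A,B) ≥ 0` for every antipode-free up-set `P₁` with `Cor_{P₁} ≥ 0` and all up-sets
  `A, B`; `triW_nonneg_andProd_clawPlusTwo`, `klShell_…`, `lForm_le_scoreVal_andProd_clawPlusTwo`.  Certificate (exact LP over the symbol cone, `k = 5`;
  general `k` needs a `k`-dependent re-pairing of the middle sorted columns and is NOT here; `clawPlusTwo_cert_identity`):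
  `2(uu' + s₀s₄' + s₁s₃' + s₂s₂' + s₃s₁' + s₄s₀' + mM' + Mm') = [u(s₀'+s₁') + (s₀+s₁)u'] + [s₄(s₀'+s₁') + (s₀+s₁)s₄'] + [(m+s₂)(M'+s₃') + (M+s₃)(m'+s₂')] + NN`
  (`m ≤ M` the sorted extra columns, `m ≤ s₁`, `M ≤ s₃`).
HONEST LABEL: complete proofs, std axioms; ONE more block (`k = 5`) of the AND-substituted-claw conjecture, which itself stays OPEN. [this work]
-/


namespace Summit.CriticalPhenomena.PercolationContinuityZ3.Theorems

namespace FiveUpSet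

open Finset

variable {γ₁ : Type} [DecidableEq γ₁] [Fintype γ₁] {k : ℕ}

/-! ### The family -/

/-- `clawPlusTwo p₁ q₁ p₂ q₂ = clawPlus p₁ q₁ ∪ {univ ∖ {p₂,q₂}}`. [this work] -/
def clawPlusTwo (p₁ q₁ p₂ q₂ : Fin k) : Finset (Finset (Fin k)) := insert ((univ.erase p₂).erase q₂) (clawPlus p₁ q₁)

/-- Membership in `clawPlusTwo`. [this work] -/
theorem mem_clawPlusTwo {p₁ q₁ p₂ q₂ : Fin k} {y : Finset (Fin k)} :
    y ∈ clawPlusTwo p₁ q₁ p₂ q₂ ↔ y = (univ.erase p₂).erase q₂ ∨ (y = (univ.erase p₁).erase q₁ ∨ k ≤ y.card + 1) := by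
  unfold clawPlusTwo; rw [mem_insert, mem_clawPlus]

/-- The second extra element is not in `clawPlus p₁ q₁`. [this work] -/
theorem erase_erase_notMem_clawPlus {p₁ q₁ p₂ q₂ : Fin k} (h : p₁ ≠ q₁ ∧ p₂ ≠ q₂ ∧ p₁ ≠ p₂ ∧ p₁ ≠ q₂ ∧ q₁ ≠ p₂ ∧ q₁ ≠ q₂) : (univ.erase p₂).erase q₂ ∉ clawPlus p₁ q₁ := by
  rw [mem_clawPlus, not_or]
  refine ⟨fun he => ?_, fun hc => erase_erase_notMem_claw h.2.1 (mem_claw.2 hc)⟩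
  have : p₁ ∈ (univ.erase p₂).erase q₂ := mem_erase.2 ⟨h.2.2.2.1, mem_erase.2 ⟨h.2.2.1, mem_univ _⟩⟩
  rw [he] at this
  exact (mem_erase.1 (mem_erase.1 this).2).1 rfl

/-- Summing over `clawPlusTwo`. [this work] -/
theorem sum_clawPlusTwo {p₁ q₁ p₂ q₂ : Fin k} (h : p₁ ≠ q₁ ∧ p₂ ≠ q₂ ∧ p₁ ≠ p₂ ∧ p₁ ≠ q₂ ∧ q₁ ≠ p₂ ∧ q₁ ≠ q₂) (f : Finset (Fin k) → ℤ) :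
    ∑ y ∈ clawPlusTwo p₁ q₁ p₂ q₂, f y = f ((univ.erase p₂).erase q₂) + ∑ y ∈ clawPlus p₁ q₁, f y := by
  unfold clawPlusTwo; rw [sum_insert (erase_erase_notMem_clawPlus h)]

/-- `clawPlusTwo` is an up-set. [this work] -/
theorem isUpperSet_clawPlusTwo {p₁ q₁ p₂ q₂ : Fin k} (h : p₁ ≠ q₁ ∧ p₂ ≠ q₂ ∧ p₁ ≠ p₂ ∧ p₁ ≠ q₂ ∧ q₁ ≠ p₂ ∧ q₁ ≠ q₂) :
    IsUpperSet (clawPlusTwo p₁ q₁ p₂ q₂ : Set (Finset (Fin k))) := by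
  intro y y' hyy' hy
  rw [mem_coe, mem_clawPlusTwo] at hy ⊢
  rcases hy with rfl | hy
  · by_cases he : y' = (univ.erase p₂).erase q₂
    · exact Or.inl he
    · right; right
      have hlt : ((univ.erase p₂).erase q₂).card < y'.card := card_lt_card (lt_of_le_of_ne hyy' (fun h' => he h'.symm))
      rw [card_erase_erase h.2.1] at hlt
      omega
  · exact Or.inr (mem_clawPlus.1 (mem_coe.1 ((isUpperSet_clawPlus h.1) hyy' (mem_coe.2 (mem_clawPlus.2 hy)))))

/-- `clawPlusTwo` is antipode free for `k ≥ 5`. [this work] -/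
theorem disjoint_clawPlusTwo_refl (hk : 5 ≤ k) {p₁ q₁ p₂ q₂ : Fin k} (h : p₁ ≠ q₁ ∧ p₂ ≠ q₂ ∧ p₁ ≠ p₂ ∧ p₁ ≠ q₂ ∧ q₁ ≠ p₂ ∧ q₁ ≠ q₂) :
    Disjoint (clawPlusTwo p₁ q₁ p₂ q₂) (refl (clawPlusTwo p₁ q₁ p₂ q₂)) := by
  rw [disjoint_left]
  intro y hy hy'
  rw [mem_refl, mem_clawPlusTwo] at hy'
  rw [mem_clawPlusTwo] at hy
  have hc := card_compl y
  rw [Fintype.card_fin] at hc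
  have hcy := card_le_univ y
  rw [Fintype.card_fin] at hcy
  have hce₁ := card_erase_erase h.1
  have hce₂ := card_erase_erase h.2.1
  -- every branch is a cardinality contradiction: the extra elements and their complements have sizes `k-2` and `2`
  have size : ∀ z : Finset (Fin k), (z = (univ.erase p₂).erase q₂ ∨ (z = (univ.erase p₁).erase q₁ ∨ k ≤ z.card + 1)) → k ≤ z.card + 2 := by
    rintro z (rfl | rfl | hz)
    · rw [hce₂]; omega
    · rw [hce₁]; omega
    · omega
  have h1 := size y hy
  have h2 := size yᶜ hy'
  omega


/-- Minimum of the two extra columns. [this work] -/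
def clawVmin (A : Finset (Finset (γ₁ ⊕ Fin k))) (p₁ q₁ p₂ q₂ : Fin k) (x : Finset γ₁) : ℤ := min (clawV A p₁ q₁ x) (clawV A p₂ q₂ x)

/-- Maximum of the two extra columns. [this work] -/
def clawVmax (A : Finset (Finset (γ₁ ⊕ Fin k))) (p₁ q₁ p₂ q₂ : Fin k) (x : Finset γ₁) : ℤ := max (clawV A p₁ q₁ x) (clawV A p₂ q₂ x)

section minmaxfacts
variable {A : Finset (Finset (γ₁ ⊕ Fin k))} (hA : IsUpperSet (A : Set (Finset (γ₁ ⊕ Fin k)))) {p₁ q₁ p₂ q₂ : Fin k}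
include hA

omit hA in
/-- Bounds of the minimum. [this work] -/
theorem clawVmin_bounds (x : Finset γ₁) : -1 ≤ clawVmin A p₁ q₁ p₂ q₂ x ∧ clawVmin A p₁ q₁ p₂ q₂ x ≤ 1 := by
  unfold clawVmin; have := clawV_bounds A p₁ q₁ x; have := clawV_bounds A p₂ q₂ x; simp only [min_def]; split_ifs <;> omega

omit hA in
/-- Bounds of the maximum. [this work] -/
theorem clawVmax_bounds (x : Finset γ₁) : -1 ≤ clawVmax A p₁ q₁ p₂ q₂ x ∧ clawVmax A p₁ q₁ p₂ q₂ x ≤ 1 := by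
  unfold clawVmax; have := clawV_bounds A p₁ q₁ x; have := clawV_bounds A p₂ q₂ x; simp only [max_def]; split_ifs <;> omega

/-- The minimum is increasing. [this work] -/
theorem clawVmin_mono {x x' : Finset γ₁} (h : x ⊆ x') : clawVmin A p₁ q₁ p₂ q₂ x ≤ clawVmin A p₁ q₁ p₂ q₂ x' := by
  unfold clawVmin; exact min_le_min (clawV_mono hA h) (clawV_mono hA h)

/-- The maximum is increasing. [this work] -/
theorem clawVmax_mono {x x' : Finset γ₁} (h : x ⊆ x') : clawVmax A p₁ q₁ p₂ q₂ x ≤ clawVmax A p₁ q₁ p₂ q₂ x' := by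
  unfold clawVmax; exact max_le_max (clawV_mono hA h) (clawV_mono hA h)

/-- Pair condition of the maximum (a unit `K`-vector). [this work] -/
theorem clawVmax_pair (hpq : p₁ ≠ q₁ ∧ p₂ ≠ q₂ ∧ p₁ ≠ p₂ ∧ p₁ ≠ q₂ ∧ q₁ ≠ p₂ ∧ q₁ ≠ q₂) {x x' : Finset γ₁} (h : x ∪ x' = univ) :
    0 ≤ clawVmax A p₁ q₁ p₂ q₂ x + clawVmax A p₁ q₁ p₂ q₂ x' := by
  unfold clawVmax
  have h1 := clawV_add_clawV_nonneg hA hpq.2.2.1 hpq.2.2.2.1 hpq.2.2.2.2.1 hpq.2.2.2.2.2 h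
  have h2 := clawV_add_clawV_nonneg hA hpq.2.2.1 hpq.2.2.2.1 hpq.2.2.2.2.1 hpq.2.2.2.2.2 (by rw [union_comm]; exact h)
  simp only [max_def]; split_ifs <;> linarith

/-- Pair condition of `min + max = v₁ + v₂` (a two-layer `K`-vector). [this work] -/
theorem clawVsum_pair (hpq : p₁ ≠ q₁ ∧ p₂ ≠ q₂ ∧ p₁ ≠ p₂ ∧ p₁ ≠ q₂ ∧ q₁ ≠ p₂ ∧ q₁ ≠ q₂) {x x' : Finset γ₁} (h : x ∪ x' = univ) :
    0 ≤ (clawVmin A p₁ q₁ p₂ q₂ x + clawVmax A p₁ q₁ p₂ q₂ x) + (clawVmin A p₁ q₁ p₂ q₂ x' + clawVmax A p₁ q₁ p₂ q₂ x') := by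
  unfold clawVmin clawVmax
  have h1 := clawV_add_clawV_nonneg hA hpq.2.2.1 hpq.2.2.2.1 hpq.2.2.2.2.1 hpq.2.2.2.2.2 h
  have h2 := clawV_add_clawV_nonneg hA hpq.2.2.1 hpq.2.2.2.1 hpq.2.2.2.2.1 hpq.2.2.2.2.2 (by rw [union_comm]; exact h)
  simp only [min_def, max_def]; split_ifs <;> linarith

/-- Pair condition of the two-layer vector `min + s_j` (`j ≥ 2`). [this work] -/
theorem clawVmin_add_clawS_pair {x x' : Finset γ₁} (h : x ∪ x' = univ) (j : Fin k) (hj : 2 ≤ (j : ℕ)) :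
    0 ≤ (clawVmin A p₁ q₁ p₂ q₂ x + clawS A x j) + (clawVmin A p₁ q₁ p₂ q₂ x' + clawS A x' j) := by
  unfold clawVmin
  have h1 := clawV_add_clawS_nonneg hA (p := p₁) (q := q₁) h j hj
  have h2 := clawV_add_clawS_nonneg hA (p := p₂) (q := q₂) h j hj
  have h3 := clawV_add_clawS_nonneg hA (p := p₁) (q := q₁) (by rw [union_comm]; exact h) j hj
  have h4 := clawV_add_clawS_nonneg hA (p := p₂) (q := q₂) (by rw [union_comm]; exact h) j hj
  simp only [min_def]; split_ifs <;> linarith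

/-- Pair condition of the two-layer vector `max + s_j` (`j ≥ 2`). [this work] -/
theorem clawVmax_add_clawS_pair {x x' : Finset γ₁} (h : x ∪ x' = univ) (j : Fin k) (hj : 2 ≤ (j : ℕ)) :
    0 ≤ (clawVmax A p₁ q₁ p₂ q₂ x + clawS A x j) + (clawVmax A p₁ q₁ p₂ q₂ x' + clawS A x' j) := by
  unfold clawVmax
  have h1 := clawV_add_clawS_nonneg hA (p := p₁) (q := q₁) h j hj
  have h2 := clawV_add_clawS_nonneg hA (p := p₂) (q := q₂) h j hj
  have h3 := clawV_add_clawS_nonneg hA (p := p₁) (q := q₁) (by rw [union_comm]; exact h) j hj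
  have h4 := clawV_add_clawS_nonneg hA (p := p₂) (q := q₂) (by rw [union_comm]; exact h) j hj
  simp only [max_def]; split_ifs <;> linarith

/-- The maximum is dominated by the second-largest sorted column. [this work] -/
theorem clawVmax_le_clawS (hpq : p₁ ≠ q₁ ∧ p₂ ≠ q₂ ∧ p₁ ≠ p₂ ∧ p₁ ≠ q₂ ∧ q₁ ≠ p₂ ∧ q₁ ≠ q₂) (x : Finset γ₁) (jc : Fin k) (hjc : (jc : ℕ) = k - 2) :
    clawVmax A p₁ q₁ p₂ q₂ x ≤ clawS A x jc := by
  unfold clawVmax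
  exact max_le (clawV_le_clawS hA hpq.1 x jc hjc) (clawV_le_clawS hA hpq.2.1 x jc hjc)

/-- **The minimum is dominated by the fourth-largest sorted column** (it lies below the four co-atom columns `p₁, q₁, p₂, q₂`). [this work] -/
theorem clawVmin_le_clawS (hpq : p₁ ≠ q₁ ∧ p₂ ≠ q₂ ∧ p₁ ≠ p₂ ∧ p₁ ≠ q₂ ∧ q₁ ≠ p₂ ∧ q₁ ≠ q₂) (x : Finset γ₁) (je : Fin k) (hje : (je : ℕ) = k - 4) :
    clawVmin A p₁ q₁ p₂ q₂ x ≤ clawS A x je := by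
  by_contra hlt
  have hle : clawS A x je ≤ clawVmin A p₁ q₁ p₂ q₂ x - 1 := by omega
  rw [clawS_le_iff] at hle
  have m1 := clawV_le_clawW_left hA (p := p₁) (q := q₁) x
  have m2 := clawV_le_clawW_right hA (p := p₁) (q := q₁) x
  have m3 := clawV_le_clawW_left hA (p := p₂) (q := q₂) x
  have m4 := clawV_le_clawW_right hA (p := p₂) (q := q₂) x
  have hmin1 : clawVmin A p₁ q₁ p₂ q₂ x ≤ clawV A p₁ q₁ x := min_le_left _ _
  have hmin2 : clawVmin A p₁ q₁ p₂ q₂ x ≤ clawV A p₂ q₂ x := min_le_right _ _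
  -- the columns `≤ min - 1` avoid the four indices
  have hsub : (univ.filter fun i => clawW A i x ≤ clawVmin A p₁ q₁ p₂ q₂ x - 1)
      ⊆ (((univ.erase p₁).erase q₁).erase p₂).erase q₂ := by
    intro i hi
    rw [mem_filter] at hi
    refine mem_erase.2 ⟨fun e => ?_, mem_erase.2 ⟨fun e => ?_, mem_erase.2 ⟨fun e => ?_, mem_erase.2 ⟨fun e => ?_, mem_univ i⟩⟩⟩⟩ <;>
      rw [e] at hi <;> omega
  have hcard : ((((univ.erase p₁).erase q₁).erase p₂).erase q₂).card = k - 4 := by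
    have e2 : p₂ ∈ (univ.erase p₁).erase q₁ := mem_erase.2 ⟨fun e => hpq.2.2.2.2.1 e.symm, mem_erase.2 ⟨fun e => hpq.2.2.1 e.symm, mem_univ _⟩⟩
    have e3 : q₂ ∈ ((univ.erase p₁).erase q₁).erase p₂ :=
      mem_erase.2 ⟨fun e => hpq.2.1 e.symm, mem_erase.2 ⟨fun e => hpq.2.2.2.2.2 e.symm, mem_erase.2 ⟨fun e => hpq.2.2.2.1 e.symm, mem_univ _⟩⟩⟩
    rw [card_erase_of_mem e3, card_erase_of_mem e2, card_erase_erase hpq.1]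
    omega
  have := card_le_card hsub
  rw [hcard] at this
  omega

end minmaxfacts

/-! ### The row decomposition and the theorem (`k = 5`) -/

/-- Row decomposition, first step: split off the second extra column. [this work] -/
theorem corP_andProd_clawPlusTwo_eq' {p₁ q₁ p₂ q₂ : Fin k} (h : p₁ ≠ q₁ ∧ p₂ ≠ q₂ ∧ p₁ ≠ p₂ ∧ p₁ ≠ q₂ ∧ q₁ ≠ p₂ ∧ q₁ ≠ q₂)
    (P₁ : Finset (Finset γ₁)) (A B : Finset (Finset (γ₁ ⊕ Fin k))) :
    corP (andProd P₁ (clawPlusTwo p₁ q₁ p₂ q₂)) A B = (∑ x ∈ P₁, clawV A p₂ q₂ x * clawV B p₂ q₂ x) + corP (andProd P₁ (clawPlus p₁ q₁)) A B := by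
  rw [corP_eq_sum, corP_eq_sum, andProd_eq_biUnion, sum_biUnion (pairwiseDisjoint_rows P₁ _), andProd_eq_biUnion,
    sum_biUnion (pairwiseDisjoint_rows P₁ _), ← sum_add_distrib]
  refine sum_congr rfl fun x _ => ?_
  rw [sum_map, sum_map, sum_clawPlusTwo h]
  unfold clawV
  simp only [rowEmb_apply]

/-- **Row decomposition**: `Cor_{P₁ ∧ clawPlusTwo}(A,B) = Σ_{x∈P₁} [v₁v₁' + v₂v₂'] + Cor_{P₁ ∧ claw k}(A,B)`. [this work] -/
theorem corP_andProd_clawPlusTwo_eq {p₁ q₁ p₂ q₂ : Fin k} (h : p₁ ≠ q₁ ∧ p₂ ≠ q₂ ∧ p₁ ≠ p₂ ∧ p₁ ≠ q₂ ∧ q₁ ≠ p₂ ∧ q₁ ≠ q₂)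
    (P₁ : Finset (Finset γ₁)) (A B : Finset (Finset (γ₁ ⊕ Fin k))) :
    corP (andProd P₁ (clawPlusTwo p₁ q₁ p₂ q₂)) A B
      = (∑ x ∈ P₁, (clawV A p₁ q₁ x * clawV B p₁ q₁ x + clawV A p₂ q₂ x * clawV B p₂ q₂ x)) + corP (andProd P₁ (claw k)) A B := by
  rw [corP_andProd_clawPlusTwo_eq' h, corP_andProd_clawPlus_eq h.1, ← add_assoc, ← sum_add_distrib]
  congr 1
  exact sum_congr rfl fun x _ => by ring

/-- The polynomial identity behind the `k = 5` certificate. [this work] -/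
theorem clawPlusTwo_cert_identity (u s0 s1 s2 s3 s4 m M u' s0' s1' s2' s3' s4' m' M' : ℤ) :
    2 * (u * u' + s0 * s4' + s1 * s3' + s2 * s2' + s3 * s1' + s4 * s0' + m * M' + M * m')
      = (u * (s0' + s1') + (s0 + s1) * u' + s4 * (s0' + s1') + (s0 + s1) * s4' + (m + s2) * (M' + s3') + (M + s3) * (m' + s2'))
        + ((s1 - s0) * (u' - s4') + (u - s4) * (s1' - s0') + 2 * ((s2 - s1) * (s4' - s3') + (s4 - s3) * (s2' - s1'))
          + 2 * ((s2 - s1) * (u' - s4') + (u - s4) * (s2' - s1')) + ((s2 - s1) * (s3' - M') + (s3 - M) * (s2' - s1'))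
          + 2 * ((s3 - s2) * (s3' - s2')) + 2 * ((s3 - s2) * (s4' - s3') + (s4 - s3) * (s3' - s2'))
          + 2 * ((s3 - s2) * (u' - s4') + (u - s4) * (s3' - s2')) + 2 * ((s4 - s3) * (s4' - s3'))
          + 2 * ((s4 - s3) * (u' - s4') + (u - s4) * (s4' - s3')) + 2 * ((u - s4) * (u' - s4'))
          + ((s3 - M) * (s1' - m') + (s1 - m) * (s3' - M'))) := by
  ring

section mainthm
variable {P₁ : Finset (Finset γ₁)} (hP : IsUpperSet (P₁ : Set (Finset γ₁))) (hd : Disjoint P₁ (refl P₁))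
  (hcor : ∀ U V : Finset (Finset γ₁), IsUpperSet (U : Set (Finset γ₁)) → IsUpperSet (V : Set (Finset γ₁)) → 0 ≤ corP P₁ U V)
  {A B : Finset (Finset (γ₁ ⊕ Fin 5))} (hA : IsUpperSet (A : Set (Finset (γ₁ ⊕ Fin 5)))) (hB : IsUpperSet (B : Set (Finset (γ₁ ⊕ Fin 5))))

include hP hd hcor hA hB in
/-- **THEOREM (AND with the block `cocover5`, `k = 5`).**  If `P₁` is an antipode-free up-set with `Cor_{P₁} ≥ 0` on all pairs of up-sets and
`p₁ q₁ p₂ q₂ : Fin 5` are two disjoint pairs, then `Cor_{P₁ ∧ clawPlusTwo p₁ q₁ p₂ q₂}(A,B) ≥ 0` for all up-sets `A, B` of `2^{γ₁ ⊕ Fin 5}`. [this work] -/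
theorem corP_andProd_clawPlusTwo_nonneg {p₁ q₁ p₂ q₂ : Fin 5} (hpq : p₁ ≠ q₁ ∧ p₂ ≠ q₂ ∧ p₁ ≠ p₂ ∧ p₁ ≠ q₂ ∧ q₁ ≠ p₂ ∧ q₁ ≠ q₂) :
    0 ≤ corP (andProd P₁ (clawPlusTwo p₁ q₁ p₂ q₂)) A B := by
  rw [corP_andProd_clawPlusTwo_eq hpq, corP_andProd_claw_eq]
  -- abbreviations (as functions, no `set`)
  have r0 : Fin.rev (0 : Fin 5) = 4 := by decide
  have r1 : Fin.rev (1 : Fin 5) = 3 := by decide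
  have r2 : Fin.rev (2 : Fin 5) = 2 := by decide
  have r3 : Fin.rev (3 : Fin 5) = 1 := by decide
  have r4 : Fin.rev (4 : Fin 5) = 0 := by decide
  -- (1) pointwise: rearrangements
  have step1 : ∀ x ∈ P₁,
      (clawU A x * clawU B x + clawS A x 0 * clawS B x 4 + clawS A x 1 * clawS B x 3 + clawS A x 2 * clawS B x 2
        + clawS A x 3 * clawS B x 1 + clawS A x 4 * clawS B x 0
        + clawVmin A p₁ q₁ p₂ q₂ x * clawVmax B p₁ q₁ p₂ q₂ x + clawVmax A p₁ q₁ p₂ q₂ x * clawVmin B p₁ q₁ p₂ q₂ x)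
      ≤ (clawV A p₁ q₁ x * clawV B p₁ q₁ x + clawV A p₂ q₂ x * clawV B p₂ q₂ x)
        + (clawU A x * clawU B x + ∑ i : Fin 5, clawW A i x * clawW B i x) := by
    intro x _
    have hr := rearr_clawS A B x
    rw [Fin.sum_univ_five, r0, r1, r2, r3, r4] at hr
    have hv := rearr_two (clawV A p₁ q₁ x) (clawV A p₂ q₂ x) (clawV B p₁ q₁ x) (clawV B p₂ q₂ x)
    unfold clawVmin clawVmax
    linarith
  -- (2) pointwise: certificate, NN ≥ 0
  have step2 : ∀ x ∈ P₁,
      (clawU A x * (clawS B x 0 + clawS B x 1) + (clawS A x 0 + clawS A x 1) * clawU B x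
        + clawS A x 4 * (clawS B x 0 + clawS B x 1) + (clawS A x 0 + clawS A x 1) * clawS B x 4
        + (clawVmin A p₁ q₁ p₂ q₂ x + clawS A x 2) * (clawVmax B p₁ q₁ p₂ q₂ x + clawS B x 3)
        + (clawVmax A p₁ q₁ p₂ q₂ x + clawS A x 3) * (clawVmin B p₁ q₁ p₂ q₂ x + clawS B x 2))
      ≤ 2 * (clawU A x * clawU B x + clawS A x 0 * clawS B x 4 + clawS A x 1 * clawS B x 3 + clawS A x 2 * clawS B x 2
        + clawS A x 3 * clawS B x 1 + clawS A x 4 * clawS B x 0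
        + clawVmin A p₁ q₁ p₂ q₂ x * clawVmax B p₁ q₁ p₂ q₂ x + clawVmax A p₁ q₁ p₂ q₂ x * clawVmin B p₁ q₁ p₂ q₂ x) := by
    intro x _
    have hid := clawPlusTwo_cert_identity (clawU A x) (clawS A x 0) (clawS A x 1) (clawS A x 2) (clawS A x 3) (clawS A x 4)
      (clawVmin A p₁ q₁ p₂ q₂ x) (clawVmax A p₁ q₁ p₂ q₂ x)
      (clawU B x) (clawS B x 0) (clawS B x 1) (clawS B x 2) (clawS B x 3) (clawS B x 4) (clawVmin B p₁ q₁ p₂ q₂ x) (clawVmax B p₁ q₁ p₂ q₂ x)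
    have a10 : 0 ≤ clawS A x 1 - clawS A x 0 := sub_nonneg.2 (clawS_monotone A x (by decide))
    have a21 : 0 ≤ clawS A x 2 - clawS A x 1 := sub_nonneg.2 (clawS_monotone A x (by decide))
    have a32 : 0 ≤ clawS A x 3 - clawS A x 2 := sub_nonneg.2 (clawS_monotone A x (by decide))
    have a43 : 0 ≤ clawS A x 4 - clawS A x 3 := sub_nonneg.2 (clawS_monotone A x (by decide))
    have au4 : 0 ≤ clawU A x - clawS A x 4 := sub_nonneg.2 (clawS_le_clawU hA x 4)
    have a3M : 0 ≤ clawS A x 3 - clawVmax A p₁ q₁ p₂ q₂ x := sub_nonneg.2 (clawVmax_le_clawS hA hpq x 3 rfl)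
    have a1m : 0 ≤ clawS A x 1 - clawVmin A p₁ q₁ p₂ q₂ x := sub_nonneg.2 (clawVmin_le_clawS hA hpq x 1 rfl)
    have b10 : 0 ≤ clawS B x 1 - clawS B x 0 := sub_nonneg.2 (clawS_monotone B x (by decide))
    have b21 : 0 ≤ clawS B x 2 - clawS B x 1 := sub_nonneg.2 (clawS_monotone B x (by decide))
    have b32 : 0 ≤ clawS B x 3 - clawS B x 2 := sub_nonneg.2 (clawS_monotone B x (by decide))
    have b43 : 0 ≤ clawS B x 4 - clawS B x 3 := sub_nonneg.2 (clawS_monotone B x (by decide))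
    have bu4 : 0 ≤ clawU B x - clawS B x 4 := sub_nonneg.2 (clawS_le_clawU hB x 4)
    have b3M : 0 ≤ clawS B x 3 - clawVmax B p₁ q₁ p₂ q₂ x := sub_nonneg.2 (clawVmax_le_clawS hB hpq x 3 rfl)
    have b1m : 0 ≤ clawS B x 1 - clawVmin B p₁ q₁ p₂ q₂ x := sub_nonneg.2 (clawVmin_le_clawS hB hpq x 1 rfl)
    have n1 := mul_nonneg a10 bu4; have n2 := mul_nonneg au4 b10; have n3 := mul_nonneg a21 b43; have n4 := mul_nonneg a43 b21
    have n5 := mul_nonneg a21 bu4; have n6 := mul_nonneg au4 b21; have n7 := mul_nonneg a21 b3M; have n8 := mul_nonneg a3M b21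
    have n9 := mul_nonneg a32 b32; have n10 := mul_nonneg a32 b43; have n11 := mul_nonneg a43 b32; have n12 := mul_nonneg a32 bu4
    have n13 := mul_nonneg au4 b32; have n14 := mul_nonneg a43 b43; have n15 := mul_nonneg a43 bu4; have n16 := mul_nonneg au4 b43
    have n17 := mul_nonneg au4 bu4; have n18 := mul_nonneg a3M b1m; have n19 := mul_nonneg a1m b3M
    linarith
  -- (3) acuteness of the six K ⊗ K sums
  have bS2 : ∀ (C : Finset (Finset (γ₁ ⊕ Fin 5))) (i j : Fin 5), ∀ x ∈ P₁, -2 ≤ clawS C x i + clawS C x j ∧ clawS C x i + clawS C x j ≤ 2 :=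
    fun C i j x _ => by have := clawS_bounds C x i; have := clawS_bounds C x j; constructor <;> linarith
  have bS1 : ∀ (C : Finset (Finset (γ₁ ⊕ Fin 5))) (j : Fin 5), ∀ x ∈ P₁, -2 ≤ clawS C x j ∧ clawS C x j ≤ 2 :=
    fun C j x _ => by have := clawS_bounds C x j; constructor <;> linarith
  have bU : ∀ (C : Finset (Finset (γ₁ ⊕ Fin 5))), ∀ x ∈ P₁, -2 ≤ clawU C x ∧ clawU C x ≤ 2 :=
    fun C x _ => by have := clawU_bounds (A := C) x; constructor <;> linarith
  have bmS : ∀ (C : Finset (Finset (γ₁ ⊕ Fin 5))) (j : Fin 5), ∀ x ∈ P₁,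
      -2 ≤ clawVmin C p₁ q₁ p₂ q₂ x + clawS C x j ∧ clawVmin C p₁ q₁ p₂ q₂ x + clawS C x j ≤ 2 :=
    fun C j x _ => by have := clawVmin_bounds (A := C) (p₁ := p₁) (q₁ := q₁) (p₂ := p₂) (q₂ := q₂) x; have := clawS_bounds C x j; constructor <;> linarith
  have bMS : ∀ (C : Finset (Finset (γ₁ ⊕ Fin 5))) (j : Fin 5), ∀ x ∈ P₁,
      -2 ≤ clawVmax C p₁ q₁ p₂ q₂ x + clawS C x j ∧ clawVmax C p₁ q₁ p₂ q₂ x + clawS C x j ≤ 2 :=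
    fun C j x _ => by have := clawVmax_bounds (A := C) (p₁ := p₁) (q₁ := q₁) (p₂ := p₂) (q₂ := q₂) x; have := clawS_bounds C x j; constructor <;> linarith
  have h1 : (1 : ℕ) ≤ ((1 : Fin 5) : ℕ) := by decide
  have h4 : (1 : ℕ) ≤ ((4 : Fin 5) : ℕ) := by decide
  have h2' : (2 : ℕ) ≤ ((2 : Fin 5) : ℕ) := by decide
  have h3' : (2 : ℕ) ≤ ((3 : Fin 5) : ℕ) := by decide
  have t1 := sum_mul_nonneg_of_two hP hd hcor (fun x => clawU A x) (fun x => clawS B x 0 + clawS B x 1) (bU A) (bS2 B 0 1)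
    (fun x _ x' _ h => clawU_mono hA h) (fun x _ x' _ h => add_le_add (clawS_mono hB h 0) (clawS_mono hB h 1))
    (fun x _ x' _ h => clawU_add_clawU_nonneg hA h) (fun x _ x' _ h => clawS_add_pair hB h 0 1 h1)
  have t2 := sum_mul_nonneg_of_two hP hd hcor (fun x => clawS A x 0 + clawS A x 1) (fun x => clawU B x) (bS2 A 0 1) (bU B)
    (fun x _ x' _ h => add_le_add (clawS_mono hA h 0) (clawS_mono hA h 1)) (fun x _ x' _ h => clawU_mono hB h)
    (fun x _ x' _ h => clawS_add_pair hA h 0 1 h1) (fun x _ x' _ h => clawU_add_clawU_nonneg hB h)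
  have t3 := sum_mul_nonneg_of_two hP hd hcor (fun x => clawS A x 4) (fun x => clawS B x 0 + clawS B x 1) (bS1 A 4) (bS2 B 0 1)
    (fun x _ x' _ h => clawS_mono hA h 4) (fun x _ x' _ h => add_le_add (clawS_mono hB h 0) (clawS_mono hB h 1))
    (fun x _ x' _ h => clawS_pair_self hA h 4 h4) (fun x _ x' _ h => clawS_add_pair hB h 0 1 h1)
  have t4 := sum_mul_nonneg_of_two hP hd hcor (fun x => clawS A x 0 + clawS A x 1) (fun x => clawS B x 4) (bS2 A 0 1) (bS1 B 4)
    (fun x _ x' _ h => add_le_add (clawS_mono hA h 0) (clawS_mono hA h 1)) (fun x _ x' _ h => clawS_mono hB h 4)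
    (fun x _ x' _ h => clawS_add_pair hA h 0 1 h1) (fun x _ x' _ h => clawS_pair_self hB h 4 h4)
  have t5 := sum_mul_nonneg_of_two hP hd hcor (fun x => clawVmin A p₁ q₁ p₂ q₂ x + clawS A x 2) (fun x => clawVmax B p₁ q₁ p₂ q₂ x + clawS B x 3)
    (bmS A 2) (bMS B 3)
    (fun x _ x' _ h => add_le_add (clawVmin_mono hA h) (clawS_mono hA h 2)) (fun x _ x' _ h => add_le_add (clawVmax_mono hB h) (clawS_mono hB h 3))
    (fun x _ x' _ h => clawVmin_add_clawS_pair hA (p₁ := p₁) (q₁ := q₁) (p₂ := p₂) (q₂ := q₂) h 2 h2')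
    (fun x _ x' _ h => clawVmax_add_clawS_pair hB (p₁ := p₁) (q₁ := q₁) (p₂ := p₂) (q₂ := q₂) h 3 h3')
  have t6 := sum_mul_nonneg_of_two hP hd hcor (fun x => clawVmax A p₁ q₁ p₂ q₂ x + clawS A x 3) (fun x => clawVmin B p₁ q₁ p₂ q₂ x + clawS B x 2)
    (bMS A 3) (bmS B 2)
    (fun x _ x' _ h => add_le_add (clawVmax_mono hA h) (clawS_mono hA h 3)) (fun x _ x' _ h => add_le_add (clawVmin_mono hB h) (clawS_mono hB h 2))
    (fun x _ x' _ h => clawVmax_add_clawS_pair hA (p₁ := p₁) (q₁ := q₁) (p₂ := p₂) (q₂ := q₂) h 3 h3')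
    (fun x _ x' _ h => clawVmin_add_clawS_pair hB (p₁ := p₁) (q₁ := q₁) (p₂ := p₂) (q₂ := q₂) h 2 h2')
  -- assemble
  have hKK := sum_le_sum step2
  rw [← mul_sum] at hKK
  simp only [sum_add_distrib] at hKK t1 t2 t3 t4 t5 t6 ⊢
  have hrow := sum_le_sum step1
  simp only [sum_add_distrib] at hrow
  linarith

end mainthm

/-! ### Corollaries -/

variable {β : Type} [DecidableEq β] [Fintype β]

/-- **`TriWIneq` for `P₁ ∧ cocover5`** on every index cube, for every intersecting Kleitman shell `P₁`. [this work] -/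
theorem triW_nonneg_andProd_clawPlusTwo {p₁ q₁ p₂ q₂ : Fin 5} (hpq : p₁ ≠ q₁ ∧ p₂ ≠ q₂ ∧ p₁ ≠ p₂ ∧ p₁ ≠ q₂ ∧ q₁ ≠ p₂ ∧ q₁ ≠ q₂) {P₁ : Finset (Finset γ₁)}
    (hP : IsUpperSet (P₁ : Set (Finset γ₁))) (hd : Disjoint P₁ (refl P₁))
    (hcor : ∀ U V : Finset (Finset γ₁), IsUpperSet (U : Set (Finset γ₁)) → IsUpperSet (V : Set (Finset γ₁)) → 0 ≤ corP P₁ U V)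
    (F G : Finset β → Finset (Finset (γ₁ ⊕ Fin 5)))
    (hF : ∀ x, IsUpperSet (F x : Set (Finset (γ₁ ⊕ Fin 5)))) (hG : ∀ x, IsUpperSet (G x : Set (Finset (γ₁ ⊕ Fin 5))))
    (hFm : Monotone F) (hGm : Monotone G) :
    0 ≤ triW (andProd P₁ (clawPlusTwo p₁ q₁ p₂ q₂)) F G :=
  triW_nonneg_of_corP_nonneg (isUpperSet_andProd hP (isUpperSet_clawPlusTwo hpq))
    (fun _ _ hA hB => corP_andProd_clawPlusTwo_nonneg hP hd hcor hA hB hpq) F G hF hG hFm hGm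

/-- **The AND-product with `cocover5` is again an intersecting Kleitman shell.** [this work] -/
theorem klShell_andProd_clawPlusTwo {p₁ q₁ p₂ q₂ : Fin 5} (hpq : p₁ ≠ q₁ ∧ p₂ ≠ q₂ ∧ p₁ ≠ p₂ ∧ p₁ ≠ q₂ ∧ q₁ ≠ p₂ ∧ q₁ ≠ q₂) {P₁ : Finset (Finset γ₁)}
    (hP : IsUpperSet (P₁ : Set (Finset γ₁))) (hd : Disjoint P₁ (refl P₁))
    (hcor : ∀ U V : Finset (Finset γ₁), IsUpperSet (U : Set (Finset γ₁)) → IsUpperSet (V : Set (Finset γ₁)) → 0 ≤ corP P₁ U V) :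
    KlShell (andProd P₁ (clawPlusTwo p₁ q₁ p₂ q₂) ∪ refl (andProd P₁ (clawPlusTwo p₁ q₁ p₂ q₂))) :=
  klShell_of_corP_nonneg (disjoint_andProd_refl hd _) fun _ _ hA hB => corP_andProd_clawPlusTwo_nonneg hP hd hcor hA hB hpq

/-- **`AndShellLower` for `Q = cocover5`**: the lower sandwich bound for `P₁ ∧ clawPlusTwo p₁ q₁ p₂ q₂`. [this work] -/
theorem lForm_le_scoreVal_andProd_clawPlusTwo {p₁ q₁ p₂ q₂ : Fin 5} (hpq : p₁ ≠ q₁ ∧ p₂ ≠ q₂ ∧ p₁ ≠ p₂ ∧ p₁ ≠ q₂ ∧ q₁ ≠ p₂ ∧ q₁ ≠ q₂) {P₁ : Finset (Finset γ₁)}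
    (hP : IsUpperSet (P₁ : Set (Finset γ₁))) (hd : Disjoint P₁ (refl P₁)) (hs : KlShell (P₁ ∪ refl P₁))
    {A B : Finset (Finset (γ₁ ⊕ Fin 5))} (hA : IsUpperSet (A : Set (Finset (γ₁ ⊕ Fin 5)))) (hB : IsUpperSet (B : Set (Finset (γ₁ ⊕ Fin 5)))) :
    lForm (andProd P₁ (clawPlusTwo p₁ q₁ p₂ q₂)) A B ≤ scoreVal (secFAScore P₁ (clawPlusTwo p₁ q₁ p₂ q₂)) A B :=
  lForm_le_scoreVal_secFAScore_of_corP_nonneg (disjoint_clawPlusTwo_refl (le_refl 5) hpq)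
    (corP_andProd_clawPlusTwo_nonneg hP hd (fun U V hU hV => by rw [corP_eq_card_sub_card_of_disjoint hd]; exact hs U V hU hV) hA hB hpq)

/-- The block `cocover5 = e888a000 = ↑014 ∪ ↑023 ∪ ↑1234` of the unit's catalogue is `clawPlusTwo 2 3 1 4` on `Fin 5`. [this work] -/
theorem clawPlusTwo_cocover5 : clawPlusTwo (2 : Fin 5) 3 1 4
    = {{0, 1, 4}, {0, 2, 3}, {1, 2, 3, 4}, {0, 1, 2, 3}, {0, 1, 2, 4}, {0, 1, 3, 4}, {0, 2, 3, 4}, {0, 1, 2, 3, 4}} := by decide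

/-- The indices `2 3 1 4 : Fin 5` are two disjoint pairs (the hypothesis of the theorem for `cocover5`). [this work] -/
theorem twoPairs_cocover5 : (2 : Fin 5) ≠ 3 ∧ (1 : Fin 5) ≠ 4 ∧ (2 : Fin 5) ≠ 1 ∧ (2 : Fin 5) ≠ 4 ∧ (3 : Fin 5) ≠ 1 ∧ (3 : Fin 5) ≠ 4 := by decide

end FiveUpSet

end Summit.CriticalPhenomena.PercolationContinuityZ3.Theorems
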